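import Literature.NumberTheory.GaloisCohomology.PoitouTateRestrictedRamification
import Literature.NumberTheory.GaloisRepresentations.GaloisCohomologyCorestriction
import Literature.NumberTheory.GaloisRepresentations.ContinuousShapiroOpenCoinducedDescent
import Literature.NumberTheory.EllipticCurves.KummerSelmerStructure
import HarnessLib

/-!
# Functoriality of `Hⁿ(K, M)`, `Hⁿ(G_S, M^{N_S})`, restriction / localisation / inflation and
# `Шⁿ_S(K, M)` along a morphism of discrete `Γ_K`-modules, in ALL degrees

Theorems only (no definition, no named fact, no `sorry`, no instance, no notation).  Topic
`NumberTheory/GaloisRepresentations`; namespace `Literature.NumberTheory.GaloisRepresentations`.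

For a morphism `F : M → M'` of discrete `Γ_K`-modules (a morphism `ρ.toTopRep ⟶ ρ'.toTopRep` of
Mathlib's `TopRep`, or a `ContIntertwiningMap` `f : ρ.toContRepresentation →ⁱL ρ'.toContRepresentation`)
the tree has the induced maps `galoisCohomology.map f n : Hⁿ(K, M) → Hⁿ(K, M')`
(`GaloisCohomology.lean`), `cohomologyMap F n` (`ContinuousCohomologyConnecting.lean`) and, on the
cohomology `restrictedCohomology ρ S n = Hⁿ(G_S, M^{N_S})` of the group with restricted ramification
(`PoitouTateRestrictedRamification.lean`), Mathlib's
`ContinuousCohomology.map (id G_S) (ContinuousRep.invariantsHom F) n` (the spelling used by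
`IwasawaTheory/Greenberg2016/RestrictedRamificationBridge.lean` and by the natural Poitou–Tate fact
`poitouTate_shaRestricted_tateDual_natural`).  Their compatibility with restriction to a field
extension, localisation at a place and inflation `Hⁿ(G_S, M^{N_S}) → Hⁿ(K, M)` was in the tree only in
degree `1`, by cocycle computations (`galoisCohomology.res_map_one`, `…localization_map_one`,
`Greenberg2016.restrictedInf_map_invariantsHom`, `Greenberg2016.restrictedInf_invariantsHom_map`).
This file proves them in EVERY degree from Mathlib's functoriality `ContinuousCohomology.map_comp`
(both composites are `Hⁿ` of one and the same compatible pair) — Serre's "compatible pairs":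

* §1 `galoisCohomology.cohomologyMap_eq_map` (the two global spellings agree),
  `galoisCohomology.res_map`, `galoisCohomology.localization_map` (all `n`);
* §2 `DiscreteGaloisModule.invariantsHom_map_eq_cohomologyMap`, `…_comp_apply`, `…_id_apply`
  (the maps on `Hⁿ(G_S, ·^{N_S})` compose), `DiscreteGaloisModule.restrictedInf_map` (inflation
  commutes with `F`, all `n`), `DiscreteGaloisModule.restrictedLocalization_map`,
  **`DiscreteGaloisModule.map_mem_shaRestricted`** (`F_* Шⁿ_S(K, M) ≤ Шⁿ_S(K, M')`).

No arithmetic is asserted; nothing about Poitou–Tate duality or BSD is proved here.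
AI formalisation, weaker than expert review; the statements are established only by the kernel check.

## References
* J.-P. Serre, *Galois Cohomology* (1997), Ch. I §2.4 (compatible pairs), Ch. II §6.1.
  [SerreGaloisCohomology1997]
* D. Harari, *Galois Cohomology and Class Field Theory*, Universitext (2020), §17.2 (p. 290): the
  restriction maps `Hⁱ(G_S, M) → Hⁱ(G_v, M)`. [Harari2020]
-/

noncomputable section

open Function NumberField Field IsDedekindDomain CategoryTheory
open scoped NumberField ContRepresentation

universe u

namespace Literature.NumberTheory.GaloisRepresentations

open _root_.TopRep _root_.ContinuousCohomology
open DiscreteGaloisModule (restrictedCohomology restrictedLocalization restrictedInf shaRestricted)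

/-! ## §1. `Hⁿ(K, ·)`: the two spellings, restriction and localisation, all degrees -/

section Global

variable {K : Type u} [Field K] {M : Type u} [AddCommGroup M] [TopologicalSpace M]
  [DiscreteTopology M] {M' : Type u} [AddCommGroup M'] [TopologicalSpace M'] [DiscreteTopology M']
  {ρ : DiscreteGaloisModule K M} {ρ' : DiscreteGaloisModule K M'}

/-- The two spellings of `Hⁿ(K, F)` agree: `cohomologyMap F n = galoisCohomology.map F.hom n`.
[cite: SerreGaloisCohomology1997, Ch. I §2.2] -/
theorem galoisCohomology.cohomologyMap_eq_map (F : ρ.toTopRep ⟶ ρ'.toTopRep) (n : ℕ)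
    (x : galoisCohomology ρ n) : cohomologyMap F n x = galoisCohomology.map F.hom n x := rfl

/-- The same for a `ContIntertwiningMap`: `cohomologyMap (TopRep.ofHom f) n = galoisCohomology.map f n`.
[cite: SerreGaloisCohomology1997, Ch. I §2.2] -/
theorem galoisCohomology.cohomologyMap_ofHom_eq_map
    (f : ρ.toContRepresentation →ⁱL ρ'.toContRepresentation) (n : ℕ) (x : galoisCohomology ρ n) :
    cohomologyMap (TopRep.ofHom f : ρ.toTopRep ⟶ ρ'.toTopRep) n x = galoisCohomology.map f n x := rfl

/-- **Restriction commutes with the change of coefficients, in every degree**: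
`res_L ∘ Hⁿ(f) = Hⁿ(f|_{Γ_L}) ∘ res_L : Hⁿ(K, M) → Hⁿ(L, M')` (both composites are `Hⁿ` of the
compatible pair (`Γ_L → Γ_K`, `f`); Mathlib `ContinuousCohomology.map_comp`).  Degree `1` was
`galoisCohomology.res_map_one`. [cite: SerreGaloisCohomology1997, Ch. I §2.4] -/
theorem galoisCohomology.res_map (L : Type u) [Field L] [Algebra K L]
    (f : ρ.toContRepresentation →ⁱL ρ'.toContRepresentation) (n : ℕ) (c : galoisCohomology ρ n) :
    galoisCohomology.res ρ' L n (galoisCohomology.map f n c) =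
      galoisCohomology.map (f.restrictField L) n (galoisCohomology.res ρ L n c) := by
  let a : absoluteGaloisGroup L →ₜ* absoluteGaloisGroup K := absGaloisRestrict K L
  let idK := ContinuousMonoidHom.id (absoluteGaloisGroup K)
  let idL := ContinuousMonoidHom.id (absoluteGaloisGroup L)
  -- the four morphisms
  let Fm : TopRep.res (idK : absoluteGaloisGroup K →* absoluteGaloisGroup K) ρ.toTopRep ⟶ ρ'.toTopRep :=
    TopRep.ofHom ⟨f.toContinuousLinearMap, f.isIntertwining'⟩
  let I' : TopRep.res (a : absoluteGaloisGroup L →* absoluteGaloisGroup K) ρ'.toTopRep ⟶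
      DiscreteGaloisModule.toTopRep (ρ'.restrictField L) :=
    TopRep.ofHom ⟨ContinuousLinearMap.id ℤ M', fun _ => rfl⟩
  let I : TopRep.res (a : absoluteGaloisGroup L →* absoluteGaloisGroup K) ρ.toTopRep ⟶
      DiscreteGaloisModule.toTopRep (ρ.restrictField L) :=
    TopRep.ofHom ⟨ContinuousLinearMap.id ℤ M, fun _ => rfl⟩
  let Fm' : TopRep.res (idL : absoluteGaloisGroup L →* absoluteGaloisGroup L)
      (DiscreteGaloisModule.toTopRep (ρ.restrictField L)) ⟶
      DiscreteGaloisModule.toTopRep (ρ'.restrictField L) :=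
    TopRep.ofHom ⟨(f.restrictField L).toContinuousLinearMap, (f.restrictField L).isIntertwining'⟩
  have h1 := ContinuousCohomology.map_comp idK a (X := ρ.toTopRep) (Y := ρ'.toTopRep)
    (Z := DiscreteGaloisModule.toTopRep (ρ'.restrictField L)) Fm I' n
  have h2 := ContinuousCohomology.map_comp a idL (X := ρ.toTopRep)
    (Y := DiscreteGaloisModule.toTopRep (ρ.restrictField L))
    (Z := DiscreteGaloisModule.toTopRep (ρ'.restrictField L)) I Fm' n
  have key : ContinuousCohomology.map idK Fm n ≫ ContinuousCohomology.map a I' n =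
      ContinuousCohomology.map a I n ≫ ContinuousCohomology.map idL Fm' n := by
    rw [← h1, ← h2]
    exact ContinuousCohomology.map_congr_of_eq (by ext; rfl) _ _ (fun _ => rfl) n
  exact congrArg (fun T => TopModuleCat.Hom.hom T c) key

/-- **Localisation commutes with the change of coefficients, in every degree**:
`loc_v (Hⁿ(f) c) = Hⁿ(f_v) (loc_v c)`.  Degree `1` was `…localization_map_one`.
[cite: SerreGaloisCohomology1997, Ch. II §6.1] -/
theorem galoisCohomology.localization_map [NumberField K]
    (f : ρ.toContRepresentation →ⁱL ρ'.toContRepresentation) (v : Place K) (n : ℕ)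
    (c : galoisCohomology ρ n) :
    galoisCohomology.localization ρ' v n (galoisCohomology.map f n c) =
      galoisCohomology.map (f.restrictField (v.Completion)) n (galoisCohomology.localization ρ v n c) :=
  galoisCohomology.res_map (v.Completion) f n c

end Global

/-! ## §2. `Hⁿ(G_S, ·^{N_S})`: composition, inflation, localisation and `Шⁿ_S` along `F` -/

section Restricted

variable {K : Type u} [Field K] {M : Type u} [AddCommGroup M] [TopologicalSpace M]
  [DiscreteTopology M] {M' : Type u} [AddCommGroup M'] [TopologicalSpace M'] [DiscreteTopology M']
  {M'' : Type u} [AddCommGroup M''] [TopologicalSpace M''] [DiscreteTopology M'']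
  {ρ : DiscreteGaloisModule K M} {ρ' : DiscreteGaloisModule K M'} {ρ'' : DiscreteGaloisModule K M''}

/-- The map `Hⁿ(G_S, F)` on `Hⁿ(G_S, ·^{N_S})` in its raw Mathlib spelling is the tree's `cohomologyMap` of
`ContinuousRep.invariantsHom F`. [cite: SerreGaloisCohomology1997, Ch. I §2.2] -/
theorem DiscreteGaloisModule.invariantsHom_map_eq_cohomologyMap (F : ρ.toTopRep ⟶ ρ'.toTopRep)
    (S : Set (HeightOneSpectrum (𝓞 K))) (n : ℕ) (c : restrictedCohomology ρ S n) :
    (ContinuousCohomology.map (ContinuousMonoidHom.id (GaloisGroupUnramifiedOutside K S))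
        (ContinuousRep.invariantsHom (N := ramificationSubgroup K S) F) n).hom c =
      cohomologyMap (ContinuousRep.invariantsHom (N := ramificationSubgroup K S) F) n c := by
  have h : ContinuousCohomology.map (ContinuousMonoidHom.id (GaloisGroupUnramifiedOutside K S))
      (X := (ρ.quotientInvariants (ramificationSubgroup K S)).toTopRep)
      (ContinuousRep.invariantsHom (N := ramificationSubgroup K S) F) n =
      cohomologyMap (ContinuousRep.invariantsHom (N := ramificationSubgroup K S) F) n :=
    ContinuousCohomology.map_congr_of_eq rfl _ _ (fun _ => rfl) n
  exact congrArg (fun T => TopModuleCat.Hom.hom T c) h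

/-- **`Hⁿ(G_S, F' ∘ F) = Hⁿ(G_S, F') ∘ Hⁿ(G_S, F)`** on `Hⁿ(G_S, ·^{N_S})`.
[cite: SerreGaloisCohomology1997, Ch. I §2.2] -/
theorem DiscreteGaloisModule.invariantsHom_map_comp_apply (F : ρ.toTopRep ⟶ ρ'.toTopRep)
    (F' : ρ'.toTopRep ⟶ ρ''.toTopRep) (S : Set (HeightOneSpectrum (𝓞 K))) (n : ℕ)
    (c : restrictedCohomology ρ S n) :
    (ContinuousCohomology.map (ContinuousMonoidHom.id (GaloisGroupUnramifiedOutside K S))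
        (ContinuousRep.invariantsHom (N := ramificationSubgroup K S) (F ≫ F')) n).hom c =
      (ContinuousCohomology.map (ContinuousMonoidHom.id (GaloisGroupUnramifiedOutside K S))
        (ContinuousRep.invariantsHom (N := ramificationSubgroup K S) F') n).hom
        ((ContinuousCohomology.map (ContinuousMonoidHom.id (GaloisGroupUnramifiedOutside K S))
          (ContinuousRep.invariantsHom (N := ramificationSubgroup K S) F) n).hom c) := by
  let N := ramificationSubgroup K S
  let idS := ContinuousMonoidHom.id (GaloisGroupUnramifiedOutside K S)
  have h1 := ContinuousCohomology.map_comp idS idS (X := (ρ.quotientInvariants N).toTopRep)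
    (Y := (ρ'.quotientInvariants N).toTopRep) (Z := (ρ''.quotientInvariants N).toTopRep)
    (ContinuousRep.invariantsHom (N := N) F) (ContinuousRep.invariantsHom (N := N) F') n
  have key : ContinuousCohomology.map idS (X := (ρ.quotientInvariants N).toTopRep)
        (Y := (ρ''.quotientInvariants N).toTopRep) (ContinuousRep.invariantsHom (N := N) (F ≫ F')) n =
      ContinuousCohomology.map idS (X := (ρ.quotientInvariants N).toTopRep)
          (Y := (ρ'.quotientInvariants N).toTopRep) (ContinuousRep.invariantsHom (N := N) F) n ≫
        ContinuousCohomology.map idS (X := (ρ'.quotientInvariants N).toTopRep)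
          (Y := (ρ''.quotientInvariants N).toTopRep) (ContinuousRep.invariantsHom (N := N) F') n := by
    rw [← h1]
    exact ContinuousCohomology.map_congr_of_eq (by ext; rfl) _ _ (fun _ => rfl) n
  exact congrArg (fun T => TopModuleCat.Hom.hom T c) key

/-- **`Hⁿ(G_S, id) = id`** on `Hⁿ(G_S, ·^{N_S})`. [cite: SerreGaloisCohomology1997, Ch. I §2.2] -/
theorem DiscreteGaloisModule.invariantsHom_map_id_apply (S : Set (HeightOneSpectrum (𝓞 K))) (n : ℕ)
    (c : restrictedCohomology ρ S n) :
    (ContinuousCohomology.map (ContinuousMonoidHom.id (GaloisGroupUnramifiedOutside K S))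
        (ContinuousRep.invariantsHom (N := ramificationSubgroup K S) (𝟙 ρ.toTopRep)) n).hom c = c := by
  have h : ContinuousCohomology.map (ContinuousMonoidHom.id (GaloisGroupUnramifiedOutside K S))
      (X := (ρ.quotientInvariants (ramificationSubgroup K S)).toTopRep)
      (ContinuousRep.invariantsHom (N := ramificationSubgroup K S) (𝟙 ρ.toTopRep)) n = 𝟙 _ :=
    continuousCohomology_map_eq_id _ _ rfl (fun _ => rfl) n
  exact congrArg (fun T => TopModuleCat.Hom.hom T c) h

/-- **Inflation commutes with the change of coefficients, in every degree**:
`inf ∘ Hⁿ(G_S, F) = Hⁿ(K, F) ∘ inf : Hⁿ(G_S, M^{N_S}) → Hⁿ(K, M')` (both composites are `Hⁿ` of the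
compatible pair (`Γ_K ↠ G_S`, `M^{N_S} ⊆ M → M'`)).  Degree `1` was
`Greenberg2016.restrictedInf_invariantsHom_map`. [cite: SerreGaloisCohomology1997, Ch. I §2.4]
[cite: Harari2020, §17.2 (p. 290)] -/
theorem DiscreteGaloisModule.restrictedInf_map (F : ρ.toTopRep ⟶ ρ'.toTopRep)
    (S : Set (HeightOneSpectrum (𝓞 K))) (n : ℕ) (c : restrictedCohomology ρ S n) :
    restrictedInf ρ' S n
        ((ContinuousCohomology.map (ContinuousMonoidHom.id (GaloisGroupUnramifiedOutside K S))
          (ContinuousRep.invariantsHom (N := ramificationSubgroup K S) F) n).hom c) =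
      cohomologyMap F n (restrictedInf ρ S n c) := by
  let N := ramificationSubgroup K S
  let qm : absoluteGaloisGroup K →ₜ* GaloisGroupUnramifiedOutside K S := ContinuousMonoidHom.quotientMk N
  let idS := ContinuousMonoidHom.id (GaloisGroupUnramifiedOutside K S)
  let idK := ContinuousMonoidHom.id (absoluteGaloisGroup K)
  -- the four morphisms
  let Fi : TopRep.res (idS : GaloisGroupUnramifiedOutside K S →* GaloisGroupUnramifiedOutside K S)
      (ρ.quotientInvariants N).toTopRep ⟶ (ρ'.quotientInvariants N).toTopRep :=
    ContinuousRep.invariantsHom (N := N) F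
  let Sub' : TopRep.res (qm : absoluteGaloisGroup K →* GaloisGroupUnramifiedOutside K S)
      (ρ'.quotientInvariants N).toTopRep ⟶ ρ'.toTopRep :=
    TopRep.ofHom ⟨Submodule.subtypeL _, fun _ => rfl⟩
  let Sub : TopRep.res (qm : absoluteGaloisGroup K →* GaloisGroupUnramifiedOutside K S)
      (ρ.quotientInvariants N).toTopRep ⟶ ρ.toTopRep :=
    TopRep.ofHom ⟨Submodule.subtypeL _, fun _ => rfl⟩
  let Fm : TopRep.res (idK : absoluteGaloisGroup K →* absoluteGaloisGroup K) ρ.toTopRep ⟶ ρ'.toTopRep :=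
    resIdHom F
  have h1 := ContinuousCohomology.map_comp idS qm (X := (ρ.quotientInvariants N).toTopRep)
    (Y := (ρ'.quotientInvariants N).toTopRep) (Z := ρ'.toTopRep) Fi Sub' n
  have h2 := ContinuousCohomology.map_comp qm idK (X := (ρ.quotientInvariants N).toTopRep)
    (Y := ρ.toTopRep) (Z := ρ'.toTopRep) Sub Fm n
  have key : ContinuousCohomology.map idS Fi n ≫ ContinuousCohomology.map qm Sub' n =
      ContinuousCohomology.map qm Sub n ≫ ContinuousCohomology.map idK Fm n := by
    rw [← h1, ← h2]
    exact ContinuousCohomology.map_congr_of_eq (by ext; rfl) _ _ (fun _ => rfl) n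
  exact congrArg (fun T => TopModuleCat.Hom.hom T c) key

variable [NumberField K]

/-- **Localisation on `Hⁿ(G_S, ·^{N_S})` commutes with the change of coefficients, in every degree**:
`loc_v (Hⁿ(G_S, F) c) = Hⁿ(F_v) (loc_v c) : Hⁿ(G_S, M^{N_S}) → Hⁿ(K_v, M')`.
[cite: Harari2020, §17.2 (p. 290)] [cite: SerreGaloisCohomology1997, Ch. II §6.1] -/
theorem DiscreteGaloisModule.restrictedLocalization_map (F : ρ.toTopRep ⟶ ρ'.toTopRep)
    (S : Set (HeightOneSpectrum (𝓞 K))) (v : Place K) (n : ℕ) (c : restrictedCohomology ρ S n) :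
    restrictedLocalization ρ' S v n
        ((ContinuousCohomology.map (ContinuousMonoidHom.id (GaloisGroupUnramifiedOutside K S))
          (ContinuousRep.invariantsHom (N := ramificationSubgroup K S) F) n).hom c) =
      galoisCohomology.map (F.hom.restrictField (v.Completion)) n (restrictedLocalization ρ S v n c) := by
  rw [DiscreteGaloisModule.restrictedLocalization_apply, DiscreteGaloisModule.restrictedLocalization_apply,
    DiscreteGaloisModule.restrictedInf_map, galoisCohomology.cohomologyMap_eq_map,
    galoisCohomology.localization_map]

/-- **`Hⁿ(G_S, F)` carries `Шⁿ_S(K, M)` into `Шⁿ_S(K, M')`** (localisation commutes with `F`).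
[cite: Harari2020, §17.3 (p. 294)] [cite: SerreGaloisCohomology1997, Ch. II §6.1] -/
theorem DiscreteGaloisModule.map_mem_shaRestricted (F : ρ.toTopRep ⟶ ρ'.toTopRep)
    (S : Set (HeightOneSpectrum (𝓞 K))) (n : ℕ) {c : restrictedCohomology ρ S n}
    (hc : c ∈ shaRestricted ρ S n) :
    (ContinuousCohomology.map (ContinuousMonoidHom.id (GaloisGroupUnramifiedOutside K S))
        (ContinuousRep.invariantsHom (N := ramificationSubgroup K S) F) n).hom c ∈ shaRestricted ρ' S n := by
  rw [DiscreteGaloisModule.mem_shaRestricted_iff] at hc ⊢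
  refine ⟨fun w => ?_, fun v hv => ?_⟩
  · rw [DiscreteGaloisModule.restrictedLocalization_map, hc.1 w]
    exact map_zero _
  · rw [DiscreteGaloisModule.restrictedLocalization_map, hc.2 v hv]
    exact map_zero _

/-- The same on the subtype: the restriction `Шⁿ_S(K, M) → Шⁿ_S(K, M')` of `Hⁿ(G_S, F)` exists, with the
expected value (values-form, as consumed by `poitouTate_shaRestricted_tateDual_natural` (N)).
[cite: Harari2020, §17.3 (p. 294)] -/
theorem DiscreteGaloisModule.exists_shaRestricted_map_eq (F : ρ.toTopRep ⟶ ρ'.toTopRep)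
    (S : Set (HeightOneSpectrum (𝓞 K))) (n : ℕ) (x : ↥(shaRestricted ρ S n)) :
    ∃ x' : ↥(shaRestricted ρ' S n), (x' : restrictedCohomology ρ' S n) =
      (ContinuousCohomology.map (ContinuousMonoidHom.id (GaloisGroupUnramifiedOutside K S))
        (ContinuousRep.invariantsHom (N := ramificationSubgroup K S) F) n).hom
        (x : restrictedCohomology ρ S n) :=
  ⟨⟨_, DiscreteGaloisModule.map_mem_shaRestricted F S n x.2⟩, rfl⟩

end Restricted

end Literature.NumberTheory.GaloisRepresentations

end
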